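import Summits.Langlands.Langlands.Theses.ExteriorSquareAscent
import Literature.NumberTheory.Automorphic.ExteriorSquareTwoTwoIdentity

/-!
# Stub `stub_twoTwoIdentity` of line `Sketch` for crux stmt-Langlands-18054
(`Summit.Langlands.Langlands.Theses.ExteriorSquareAscent.ReducibleInducesSquare`)

The Euler-factor identity of the `(2,2)` case (Shavali 2026, arXiv:2603.19768, proof of
Prop. 4.2), in the explicit form consumed by the lead's analytic stub `stub_noPlanesAnalytic` at a
good place with `t_{π,v} = {a, b} + {c, d}`, `χ(ϖ_v) = ab`, `ω(ϖ_v) = abcd`: with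
`ℓ = cd (ab)⁻¹`,
`P(t, t⁻¹ℓ) P(t, t⁻¹ℓ²) P(∧²t, χ⁻¹ℓ)² P(1, 1) P(ℓ³, 1)
  = P(t, t χ⁻¹ℓ) P(t⁻¹, t⁻¹ χℓ²) P(∧²t, χ⁻¹) P(∧²t, χ⁻¹ℓ²) P(ℓ, 1) P(ℓ², 1)`.
A thin wrapper around the Literature theorem `satakePairPolynomial_twoTwo_identity`
(`Literature/NumberTheory/Automorphic/ExteriorSquareTwoTwoIdentity.lean`), where both sides are
identified with the Euler polynomial of one `46`-element multiset of pair parameters.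
-/

set_option linter.dupNamespace false -- `Summit.Langlands.Langlands` is the mandated namespace

noncomputable section

namespace Summit.Langlands.Langlands.Cruxes.ReducibleInducesSquare.Sketch

open Literature.NumberTheory.Automorphic

/-- **The `46`-term Euler-factor identity of the `(2,2)` case** (registered stub
`stub_twoTwoIdentity` of line `Sketch`): for non-zero `a, b, c, d`, with `t = {a, b, c, d}`,
`χ = ab`, `ℓ = cd (ab)⁻¹`,
`P(t, t⁻¹ℓ) P(t, t⁻¹ℓ²) P(∧²t, χ⁻¹ℓ)² P(1, 1) P(ℓ³, 1)
  = P(t, t χ⁻¹ℓ) P(t⁻¹, t⁻¹ χℓ²) P(∧²t, χ⁻¹) P(∧²t, χ⁻¹ℓ²) P(ℓ, 1) P(ℓ², 1)`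
(`satakePairPolynomial_twoTwo_identity`). [cite: Shavali2026GL4, Prop. 4.2] -/
theorem stub_twoTwoIdentity :
    ∀ (a b c d : ℂ), a ≠ 0 → b ≠ 0 → c ≠ 0 → d ≠ 0 →
      Literature.NumberTheory.Automorphic.satakePairPolynomial {a, b, c, d}
          ((({a, b, c, d} : Multiset ℂ).map (·⁻¹)).map (c * d * (a * b)⁻¹ * ·)) *
        Literature.NumberTheory.Automorphic.satakePairPolynomial {a, b, c, d}
          ((({a, b, c, d} : Multiset ℂ).map (·⁻¹)).map ((c * d * (a * b)⁻¹) ^ 2 * ·)) *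
        Literature.NumberTheory.Automorphic.satakePairPolynomial
          (Literature.NumberTheory.Automorphic.wedgeTwoParams {a, b, c, d})
          {(a * b)⁻¹ * (c * d * (a * b)⁻¹)} *
        Literature.NumberTheory.Automorphic.satakePairPolynomial
          (Literature.NumberTheory.Automorphic.wedgeTwoParams {a, b, c, d})
          {(a * b)⁻¹ * (c * d * (a * b)⁻¹)} *
        Literature.NumberTheory.Automorphic.satakePairPolynomial {1} {1} *
        Literature.NumberTheory.Automorphic.satakePairPolynomial {(c * d * (a * b)⁻¹) ^ 3} {1} =
      Literature.NumberTheory.Automorphic.satakePairPolynomial {a, b, c, d}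
          (({a, b, c, d} : Multiset ℂ).map ((a * b)⁻¹ * (c * d * (a * b)⁻¹) * ·)) *
        Literature.NumberTheory.Automorphic.satakePairPolynomial (({a, b, c, d} : Multiset ℂ).map (·⁻¹))
          ((({a, b, c, d} : Multiset ℂ).map (·⁻¹)).map (a * b * (c * d * (a * b)⁻¹) ^ 2 * ·)) *
        Literature.NumberTheory.Automorphic.satakePairPolynomial
          (Literature.NumberTheory.Automorphic.wedgeTwoParams {a, b, c, d}) {(a * b)⁻¹} *
        Literature.NumberTheory.Automorphic.satakePairPolynomial
          (Literature.NumberTheory.Automorphic.wedgeTwoParams {a, b, c, d})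
          {(a * b)⁻¹ * (c * d * (a * b)⁻¹) ^ 2} *
        Literature.NumberTheory.Automorphic.satakePairPolynomial {c * d * (a * b)⁻¹} {1} *
        Literature.NumberTheory.Automorphic.satakePairPolynomial {(c * d * (a * b)⁻¹) ^ 2} {1} :=
  fun _ _ _ _ ha hb hc hd => satakePairPolynomial_twoTwo_identity ha hb hc hd

end Summit.Langlands.Langlands.Cruxes.ReducibleInducesSquare.Sketch
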